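import Summits.HodgeConjecture.HodgeConjecture.Theorems.K2E4ArchGPrimeDefs                      -- ★ p855236 (this seat): `wallPoint` & co.
import Literature.NumberTheory.Rogawski1990.ArchLimitFormulaNoncompactWallSelfNormalisingPin    -- ★ `exists_centralizer_measure_clause_neg_one` (the `(−1)`-pinned reference measure exists)
import Literature.NumberTheory.Rogawski1990.ArchUniversalPinRatioOfWallCompatible             -- ★ U5 §1: `isInvInvariant_of_isHaarMeasure_centralizer_wall`, `locallyCompactSpace_secondCountable_centralizer_archLocal`
import Literature.NumberTheory.Rogawski1990.ArchCentralDescentAssemblyKit                      -- ★ (S3) `UnitaryGroup.isMulRightInvariant_of_isHaarMeasure_archLocal_diagonal` (unimodularity of `U(σ_w diag β)(ℂ)`)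
import HarnessLib

/-!
# The `G′`-package, (pins): the `(−1)`-PINNED reference centraliser measures at the wall point EXIST (Rogawski 1990 §8.2 pp. 118–119, p. 123, §1.7 p. 6)

Track B ∕ K2-LIT, crux h413 = `stmt-HodgeConjecture-24833`; prover seat `hodgecm-mathlib-K2E4-p11` (g0), V2 «G′ PACKAGE» for the assembler K2E4-p09 (`--supports … --as helper`).
**`exists_pinnedRefs`** — for a hermitian non-degenerate diagonal frame `α` and rational `e₁ ≠ e₂` on the unit circle there is a family `νH w τ` of inversion-invariant Haar measures on
the wall centralisers `Z(diag z⁰_w) ≤ G_w(α∘τ)` (`z⁰_w = (σ_w e₁, σ_w e₂, σ_w e₁)`) which at every NONCOMPACT wall satisfies the (J-nc) clause of ★ `ArchLimitFormulaNoncompactWall` with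
constant EXACTLY `−1` for some Haar measure of the group (★ `exists_centralizer_measure_clause_neg_one`; print's «compatible measures … the constant in the limit formula for `H′` differs
by a sign», here in the (U) road's pin convention); at the compact walls any inversion-invariant Haar measure (★ `isInvInvariant_of_isHaarMeasure_centralizer_wall`).  The conclusion is
the `hpin` binder of ★ (U) `archSingularUniversalPinRatio_of_wallCompatible` at `z₁ := wallPoint` (shared text `K2/K2E4-p11/g0/HPIN.binder.txt`), consumed by the (step) and (end) files
and by the packer.
HONEST LABEL: HC_CM is proved only modulo the 7 printed citations (2 remaining named inputs: hLiu418 = `stmt-HodgeConjecture-24832`, h413 = `stmt-HodgeConjecture-24833`) until rung 0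
closes; bookkeeping over ★ bricks, pays nothing by itself.

## References
* [Rogawski1990] J. D. Rogawski, *Automorphic Representations of Unitary Groups in Three Variables*, Ann. of Math. Stud. 123 (1990), §1.7 p. 6; §8.2 pp. 118–119, p. 123.
* [DeitmarEchterhoff2014] A. Deitmar, S. Echterhoff, *Principles of Harmonic Analysis*, 2nd ed. (2014), Thm. 1.5.3.
* [Varadarajan1989] V. S. Varadarajan, *An Introduction to Harmonic Analysis on Semisimple Lie Groups* (1989), §6.4 Thm 22.
-/

set_option autoImplicit false
set_option linter.dupNamespace false  -- the cell's namespace convention `Summit.HodgeConjecture.HodgeConjecture.Cruxes.H413.<File>` repeats the summit = problem name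

noncomputable section

open MeasureTheory Measure Filter Topology NumberField NumberField.InfinitePlace NumberField.mixedEmbedding Equiv Function Set
open Literature.MeasureTheory.Group Literature.NumberTheory.Automorphic Literature.NumberTheory.Automorphic.UnitaryGroup
open Literature.LinearAlgebra.Matrix Literature.NumberTheory.Rogawski1990
open Summit.HodgeConjecture.HodgeConjecture.Cruxes.H413.K2E4ArchGPrimeDefs
open scoped Matrix MatrixGroups Matrix.Norms.Operator ContDiff ENNReal Classical

namespace Summit.HodgeConjecture.HodgeConjecture.Cruxes.H413.K2E4ArchGPrimePins

variable (L : Type) [Field L] [NumberField L] [IsCMField L] (α : Fin 3 → L) [MeasurableSpace (GL (Fin 3) ℂ)] [BorelSpace (GL (Fin 3) ℂ)]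

/-- **THE `(−1)`-PINNED REFERENCE CENTRALISER MEASURES EXIST** (see the module docstring): inversion-invariant Haar measures `νH w τ` on the wall centralisers of the relabelled groups
with the (J-nc) clause at constant `−1` at every noncompact wall. [cite: Rogawski1990, §8.2 p. 119; p. 123; §1.7 p. 6] [cite: DeitmarEchterhoff2014, Thm. 1.5.3] [cite: Varadarajan1989, §6.4 Thm 22] -/
theorem exists_pinnedRefs
    (hα : ∀ i, α i ≠ 0) (hherm : ∀ i, (IsCMField.complexConj L (α i) : L) = α i)
    (e₁ e₂ : L) (h₁ : (IsCMField.complexConj L e₁ : L) * e₁ = 1) (h₂ : (IsCMField.complexConj L e₂ : L) * e₂ = 1) (hne : e₁ ≠ e₂)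
    [∀ (w : {w : InfinitePlace L // IsComplex w}) (τ : Perm (Fin 3)), MeasurableSpace (archLocal L 3 (Matrix.diagonal (α ∘ ⇑τ)) w ⧸ Subgroup.centralizer
      ({(⟨circleDiagonal 3 (wallPoint L e₁ e₂ h₁ h₂ w), circleDiagonal_mem_archLocal_diagonal L 3 (α ∘ ⇑τ) w (wallPoint L e₁ e₂ h₁ h₂ w)⟩ : archLocal L 3 (Matrix.diagonal (α ∘ ⇑τ)) w)} :
        Set (archLocal L 3 (Matrix.diagonal (α ∘ ⇑τ)) w)))]
    [∀ (w : {w : InfinitePlace L // IsComplex w}) (τ : Perm (Fin 3)), BorelSpace (archLocal L 3 (Matrix.diagonal (α ∘ ⇑τ)) w ⧸ Subgroup.centralizer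
      ({(⟨circleDiagonal 3 (wallPoint L e₁ e₂ h₁ h₂ w), circleDiagonal_mem_archLocal_diagonal L 3 (α ∘ ⇑τ) w (wallPoint L e₁ e₂ h₁ h₂ w)⟩ : archLocal L 3 (Matrix.diagonal (α ∘ ⇑τ)) w)} :
        Set (archLocal L 3 (Matrix.diagonal (α ∘ ⇑τ)) w)))] :
    ∃ (νH : ∀ (w : {w : InfinitePlace L // IsComplex w}) (τ : Perm (Fin 3)), Measure (Subgroup.centralizer
      ({(⟨circleDiagonal 3 (wallPoint L e₁ e₂ h₁ h₂ w), circleDiagonal_mem_archLocal_diagonal L 3 (α ∘ ⇑τ) w (wallPoint L e₁ e₂ h₁ h₂ w)⟩ : archLocal L 3 (Matrix.diagonal (α ∘ ⇑τ)) w)} :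
        Set (archLocal L 3 (Matrix.diagonal (α ∘ ⇑τ)) w))))
      (hνH : ∀ w τ, (νH w τ).IsHaarMeasure ∧ (νH w τ).IsInvInvariant),
∀ (w : {w : InfinitePlace L // IsComplex w}) (τ : Perm (Fin 3)), (w.1.embedding (α (τ 0))).re * (w.1.embedding (α (τ 2))).re < 0 →
        haveI : LocallyCompactSpace (archLocal L 3 (Matrix.diagonal (α ∘ ⇑τ)) w) := locallyCompactSpace_archLocal L 3 (Matrix.diagonal (α ∘ ⇑τ)) w
        haveI : SecondCountableTopology (archLocal L 3 (Matrix.diagonal (α ∘ ⇑τ)) w) := secondCountableTopology_archLocal L 3 (Matrix.diagonal (α ∘ ⇑τ)) w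
        haveI : (νH w τ).IsHaarMeasure := (hνH w τ).1
        haveI : (νH w τ).IsInvInvariant := (hνH w τ).2
        ∃ (ν : Measure (archLocal L 3 (Matrix.diagonal (α ∘ ⇑τ)) w)) (_ : ν.IsHaarMeasure) (_ : ν.IsMulRightInvariant),
          ∀ (Θ : Matrix (Fin 3) (Fin 3) ℂ → ℂ), ContDiff ℝ (⊤ : ℕ∞) Θ →
            HasCompactSupport (fun k : archLocal L 3 (Matrix.diagonal (α ∘ ⇑τ)) w => Θ ((k : GL (Fin 3) ℂ) : Matrix (Fin 3) (Fin 3) ℂ)) →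
            ∀ (z₀ : Fin 3 → Circle) (h02' : z₀ 0 = z₀ 2) (h01' : z₀ 0 ≠ z₀ 1),
              Tendsto (fun ψ : ℝ => deriv (fun ψ : ℝ => (2 * Real.sin ψ : ℂ) *
                  ∫ g, Θ (((g * ⟨circleDiagonal 3 (fun i => z₀ i * Circle.exp (![(1 : ℝ), 0, -1] i * ψ)),
                    circleDiagonal_mem_archLocal_diagonal L 3 (α ∘ ⇑τ) w _⟩ * g⁻¹ : archLocal L 3 (Matrix.diagonal (α ∘ ⇑τ)) w) : GL (Fin 3) ℂ) : Matrix (Fin 3) (Fin 3) ℂ) ∂(ν)) ψ)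
                (𝓝[≠] 0)
                (𝓝 ((-1 : ℂ) * ∫ y, descConj (⟨circleDiagonal 3 z₀, circleDiagonal_mem_archLocal_diagonal L 3 (α ∘ ⇑τ) w z₀⟩ : archLocal L 3 (Matrix.diagonal (α ∘ ⇑τ)) w)
                  (Subgroup.centralizer ({(⟨circleDiagonal 3 (wallPoint L e₁ e₂ h₁ h₂ w), circleDiagonal_mem_archLocal_diagonal L 3 (α ∘ ⇑τ) w (wallPoint L e₁ e₂ h₁ h₂ w)⟩ : archLocal L 3 (Matrix.diagonal (α ∘ ⇑τ)) w)} : Set (archLocal L 3 (Matrix.diagonal (α ∘ ⇑τ)) w)))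
                  (forall_mem_centralizer_circleDiagonal_comm_of_wall L (α ∘ ⇑τ) w (wallPoint_zero_eq_two L e₁ e₂ h₁ h₂ w) (wallPoint_zero_ne_one L e₁ e₂ h₁ h₂ hne w) h02' h01')
                  (fun k : archLocal L 3 (Matrix.diagonal (α ∘ ⇑τ)) w => Θ ((k : GL (Fin 3) ℂ) : Matrix (Fin 3) (Fin 3) ℂ)) y
                  ∂(quotientMeasure _ (νH w τ) (isClosed_coe_centralizer_singleton _) (ν)))) := by
  classical
  haveI iLC : ∀ (w : {w : InfinitePlace L // IsComplex w}) (τ : Perm (Fin 3)), LocallyCompactSpace (archLocal L 3 (Matrix.diagonal (α ∘ ⇑τ)) w) :=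
    fun w τ => locallyCompactSpace_archLocal L 3 (Matrix.diagonal (α ∘ ⇑τ)) w
  haveI iSC : ∀ (w : {w : InfinitePlace L // IsComplex w}) (τ : Perm (Fin 3)), SecondCountableTopology (archLocal L 3 (Matrix.diagonal (α ∘ ⇑τ)) w) :=
    fun w τ => secondCountableTopology_archLocal L 3 (Matrix.diagonal (α ∘ ⇑τ)) w
  haveI iLCZ : ∀ (w : {w : InfinitePlace L // IsComplex w}) (τ : Perm (Fin 3)), LocallyCompactSpace (Subgroup.centralizer
      ({(⟨circleDiagonal 3 (wallPoint L e₁ e₂ h₁ h₂ w), circleDiagonal_mem_archLocal_diagonal L 3 (α ∘ ⇑τ) w (wallPoint L e₁ e₂ h₁ h₂ w)⟩ : archLocal L 3 (Matrix.diagonal (α ∘ ⇑τ)) w)} :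
        Set (archLocal L 3 (Matrix.diagonal (α ∘ ⇑τ)) w))) :=
    fun w τ => (locallyCompactSpace_secondCountable_centralizer_archLocal L (α ∘ ⇑τ) w _).1
  have hreal : ∀ (w : {w : InfinitePlace L // IsComplex w}) (τ : Perm (Fin 3)) (i : Fin 3), (w.1.embedding ((α ∘ ⇑τ) i)).im = 0 :=
    fun w τ i => im_embedding_eq_zero_of_complexConj_eq L w (hherm (τ i))
  have hατ : ∀ (τ : Perm (Fin 3)) (i : Fin 3), (α ∘ ⇑τ) i ≠ 0 := fun τ i => hα (τ i)
  -- a Haar measure on each relabelled group and a Haar measure on each wall centraliser (the compact-wall references)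
  set νG : ∀ (w : {w : InfinitePlace L // IsComplex w}) (τ : Perm (Fin 3)), Measure (archLocal L 3 (Matrix.diagonal (α ∘ ⇑τ)) w) := fun w τ => Measure.haar with hνG
  haveI iνGr : ∀ w τ, (νG w τ).IsMulRightInvariant := fun w τ =>
    UnitaryGroup.isMulRightInvariant_of_isHaarMeasure_archLocal_diagonal L (α ∘ ⇑τ) (hατ τ) (fun i => hherm (τ i)) w (νG w τ)
  set νZ : ∀ (w : {w : InfinitePlace L // IsComplex w}) (τ : Perm (Fin 3)), Measure (Subgroup.centralizer
      ({(⟨circleDiagonal 3 (wallPoint L e₁ e₂ h₁ h₂ w), circleDiagonal_mem_archLocal_diagonal L 3 (α ∘ ⇑τ) w (wallPoint L e₁ e₂ h₁ h₂ w)⟩ : archLocal L 3 (Matrix.diagonal (α ∘ ⇑τ)) w)} :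
        Set (archLocal L 3 (Matrix.diagonal (α ∘ ⇑τ)) w))) := fun w τ => Measure.haar with hνZ
  have hνZi : ∀ w τ, (νZ w τ).IsInvInvariant := fun w τ =>
    isInvInvariant_of_isHaarMeasure_centralizer_wall L (α ∘ ⇑τ) w (hατ τ) (hreal w τ) (wallPoint_zero_eq_two L e₁ e₂ h₁ h₂ w) (wallPoint_zero_ne_one L e₁ e₂ h₁ h₂ hne w) (νZ w τ)
  haveI : ∀ w τ, (νZ w τ).IsInvInvariant := hνZi
  -- at a NONCOMPACT wall: ★ the `(−1)`-pinned reference measure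
  have hpinned : ∀ (w : {w : InfinitePlace L // IsComplex w}) (τ : Perm (Fin 3)), (w.1.embedding (α (τ 0))).re * (w.1.embedding (α (τ 2))).re < 0 →
      ∃ νH : Measure (Subgroup.centralizer
        ({(⟨circleDiagonal 3 (wallPoint L e₁ e₂ h₁ h₂ w), circleDiagonal_mem_archLocal_diagonal L 3 (α ∘ ⇑τ) w (wallPoint L e₁ e₂ h₁ h₂ w)⟩ : archLocal L 3 (Matrix.diagonal (α ∘ ⇑τ)) w)} :
          Set (archLocal L 3 (Matrix.diagonal (α ∘ ⇑τ)) w))), ∃ (_ : νH.IsHaarMeasure) (_ : νH.IsInvInvariant),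
      ∀ (Θ : Matrix (Fin 3) (Fin 3) ℂ → ℂ), ContDiff ℝ (⊤ : ℕ∞) Θ →
        HasCompactSupport (fun k : archLocal L 3 (Matrix.diagonal (α ∘ ⇑τ)) w => Θ ((k : GL (Fin 3) ℂ) : Matrix (Fin 3) (Fin 3) ℂ)) →
        ∀ (z₀ : Fin 3 → Circle) (h02' : z₀ 0 = z₀ 2) (h01' : z₀ 0 ≠ z₀ 1),
          Tendsto (fun ψ : ℝ => deriv (fun ψ : ℝ => (2 * Real.sin ψ : ℂ) *
              ∫ g, Θ (((g * ⟨circleDiagonal 3 (fun i => z₀ i * Circle.exp (![(1 : ℝ), 0, -1] i * ψ)),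
                circleDiagonal_mem_archLocal_diagonal L 3 (α ∘ ⇑τ) w _⟩ * g⁻¹ : archLocal L 3 (Matrix.diagonal (α ∘ ⇑τ)) w) : GL (Fin 3) ℂ) : Matrix (Fin 3) (Fin 3) ℂ) ∂(νG w τ)) ψ)
            (𝓝[≠] 0)
            (𝓝 ((-1 : ℂ) * ∫ y, descConj (⟨circleDiagonal 3 z₀, circleDiagonal_mem_archLocal_diagonal L 3 (α ∘ ⇑τ) w z₀⟩ : archLocal L 3 (Matrix.diagonal (α ∘ ⇑τ)) w)
              (Subgroup.centralizer ({(⟨circleDiagonal 3 (wallPoint L e₁ e₂ h₁ h₂ w), circleDiagonal_mem_archLocal_diagonal L 3 (α ∘ ⇑τ) w (wallPoint L e₁ e₂ h₁ h₂ w)⟩ : archLocal L 3 (Matrix.diagonal (α ∘ ⇑τ)) w)} : Set (archLocal L 3 (Matrix.diagonal (α ∘ ⇑τ)) w)))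
              (forall_mem_centralizer_circleDiagonal_comm_of_wall L (α ∘ ⇑τ) w (wallPoint_zero_eq_two L e₁ e₂ h₁ h₂ w) (wallPoint_zero_ne_one L e₁ e₂ h₁ h₂ hne w) h02' h01')
              (fun k : archLocal L 3 (Matrix.diagonal (α ∘ ⇑τ)) w => Θ ((k : GL (Fin 3) ℂ) : Matrix (Fin 3) (Fin 3) ℂ)) y
              ∂(quotientMeasure _ νH (isClosed_coe_centralizer_singleton _) (νG w τ)))) :=
    fun w τ hnc => exists_centralizer_measure_clause_neg_one L (α ∘ ⇑τ) w (hατ τ) (hreal w τ) hnc (νG w τ) (wallPoint L e₁ e₂ h₁ h₂ w)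
      (wallPoint_zero_eq_two L e₁ e₂ h₁ h₂ w) (wallPoint_zero_ne_one L e₁ e₂ h₁ h₂ hne w) (νZ w τ)
  -- the reference family: pinned at the noncompact walls, Haar at the compact ones
  refine ⟨fun w τ => if h : (w.1.embedding (α (τ 0))).re * (w.1.embedding (α (τ 2))).re < 0 then (hpinned w τ h).choose else νZ w τ, fun w τ => ?_, ?_⟩
  · by_cases h : (w.1.embedding (α (τ 0))).re * (w.1.embedding (α (τ 2))).re < 0
    · simp only [dif_pos h]
      exact ⟨(hpinned w τ h).choose_spec.choose, (hpinned w τ h).choose_spec.choose_spec.choose⟩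
    · simp only [dif_neg h]
      exact ⟨inferInstance, hνZi w τ⟩
  · intro w τ hnc
    refine ⟨νG w τ, inferInstance, iνGr w τ, ?_⟩
    have hspec := (hpinned w τ hnc).choose_spec.choose_spec.choose_spec
    simp only [dif_pos hnc]
    exact hspec


end Summit.HodgeConjecture.HodgeConjecture.Cruxes.H413.K2E4ArchGPrimePins

end
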